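import Summits.KontsevichZagierPeriods.KontsevichZagierPeriods.Theorems.TerasomaMultiplicationBetaCancellationStubTameFormAux17
import Summits.KontsevichZagierPeriods.KontsevichZagierPeriods.Theorems.TerasomaMultiplicationBetaCancellationStubTameFormAux25

/-!
# `BetaCancellation` (stmt-KontsevichZagierPeriods-13633), line `divisor-slicing-transshipment` — stub `stub_tameForm`, auxiliary file 26: rule (3) over one open base cell

For a Newton–Leibniz generator `[band, f] − [τ, F(·,b) − F(·,a)]` and an open base cell `S ⊆ τ`
with `a < b` on `S`, over which the closed band is the union of graphs `j ∈ Gs` and bands `j ∈ Bs`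
of a stack `ξ₀ < ⋯ < ξ_{l-1}` with constant sign of `f` and differentiable `F` on each band: the
shadow of `[band ∩ cyl S, f] − [S, F(·,b) − F(·,a)]` vanishes. Bookkeeping: partition into the
bands (graphs are null), shrink the base to a conull good open sub-base (file 25), straighten each
band (file 24), telescope the boundary terms by iterated rule (1b) (files 23, 25), destabilise
(file 22).

References: M. Kontsevich, D. Zagier, *Periods* (2001), §1.2 rule (3); crux NOTES c6 (F13).
-/

noncomputable section

-- `Summit.KontsevichZagierPeriods.KontsevichZagierPeriods.…` is the tree's mandated layout (single-conjunct summit).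
set_option linter.dupNamespace false

namespace Summit.KontsevichZagierPeriods.KontsevichZagierPeriods.BetaCancellationDivisorSlicing

open MeasureTheory Set Function Filter
open scoped Topology
open Literature.NumberTheory.Transcendental
open Literature.NumberTheory.Transcendental.KZ
open Literature.ModelTheory.ExponentialFields (IsSemialgebraic isSemialgebraic_univ bandLower bandUpper bandOver graphOver
  bandLower_of_ne_zero bandUpper_of_ne_last mem_bandOver_iff mem_graphOver_iff snoc_mem_bandOver_iff snoc_mem_graphOver_iff
  isSemialgebraic_bandOver' interior_graphOver_eq_empty isSemialgebraicMapOn_snoc)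
open Literature.ModelTheory.ExponentialFields.CylindricalDecomposition (band_eq_band not_mem_band_of_eq exists_mem_band)

variable {n : ℕ}

/-- **Rule (3) over one open base cell.** [cite: KontsevichZagier2001, §1.2 rule (3)] -/
theorem exists_cellShadow (R : IntegralRep (n + 1)) (B : IntegralRep n) (a b : (Fin n → ℝ) → ℝ)
    (F : (Fin (n + 1) → ℝ) → ℝ) (hF : IsSemialgebraicFunOn ℚ R.domain F)
    (hdom : R.domain = {z | (Fin.init z : Fin n → ℝ) ∈ B.domain ∧ a (Fin.init z) ≤ z (Fin.last n) ∧ z (Fin.last n) ≤ b (Fin.init z)})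
    (hcont : ∀ x ∈ B.domain, ContinuousOn (fun t => F (Fin.snoc x t)) (Icc (a x) (b x)))
    (hderiv : ∀ x ∈ B.domain, ∀ t ∈ Ioo (a x) (b x), HasDerivAt (fun s => F (Fin.snoc x s)) (R.integrand (Fin.snoc x t)) t)
    (hval : ∀ x ∈ B.domain, B.integrand x = F (Fin.snoc x (b x)) - F (Fin.snoc x (a x)))
    {S : Set (Fin n → ℝ)} (hSo : IsOpen S) (hS : IsSemialgebraic ℚ S) (hSτ : S ⊆ B.domain) (hSne : S.Nonempty)
    (hab : ∀ x ∈ S, a x < b x)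
    {l : ℕ} (ξ : Fin l → (Fin n → ℝ) → ℝ) (hξc : ∀ j, ContinuousOn (ξ j) S) (hξs : ∀ j, IsSemialgebraicFunOn ℚ S (ξ j))
    (hmono : ∀ x ∈ S, StrictMono fun j => ξ j x)
    (Gs : Finset (Fin l)) (Bs : Finset (Fin (l + 1)))
    (hGs : ∀ j ∈ Gs, graphOver S (ξ j) ⊆ R.domain) (hBs : ∀ j ∈ Bs, bandOver S ξ j ⊆ R.domain)
    (hcov : ∀ z ∈ R.domain, (Fin.init z : Fin n → ℝ) ∈ S → (∃ j ∈ Gs, z ∈ graphOver S (ξ j)) ∨ ∃ j ∈ Bs, z ∈ bandOver S ξ j)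
    (hsign : ∀ j ∈ Bs, (∀ z ∈ bandOver S ξ j, 0 < R.integrand z) ∨ (∀ z ∈ bandOver S ξ j, R.integrand z < 0) ∨
      ∀ z ∈ bandOver S ξ j, R.integrand z = 0)
    (hsmooth : ∀ j ∈ Bs, ∀ z ∈ bandOver S ξ j, DifferentiableAt ℝ F z)
    (RS : IntegralRep (n + 1)) (hRS : RS.domain = R.domain ∩ {z | (Fin.init z : Fin n → ℝ) ∈ S}) (hRSi : RS.integrand = R.integrand)
    (BS : IntegralRep n) (hBSd : BS.domain = S) (hBSi : BS.integrand = B.integrand) :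
    Nonempty (Shadow (of RS - of BS)) := by
  classical
  -- 0. the fibre equation and the band indices
  have hfib : ∀ x ∈ S, ∀ t : ℝ, t ∈ Icc (a x) (b x) ↔
      (∃ j ∈ Gs, t = ξ j x) ∨ ∃ j ∈ Bs, bandLower ξ j x < t ∧ (t : EReal) < bandUpper ξ j x := by
    intro x hx t
    constructor
    · intro ht
      have hz : (Fin.snoc x t : Fin (n + 1) → ℝ) ∈ R.domain := by
        rw [hdom]; simpa using ⟨hSτ hx, ht.1, ht.2⟩
      rcases hcov _ hz (by simpa using hx) with ⟨j, hj, hzj⟩ | ⟨j, hj, hzj⟩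
      · exact Or.inl ⟨j, hj, (snoc_mem_graphOver_iff.mp hzj).2⟩
      · exact Or.inr ⟨j, hj, (snoc_mem_bandOver_iff.mp hzj).2⟩
    · rintro (⟨j, hj, rfl⟩ | ⟨j, hj, hlo, hup⟩)
      · have := hGs j hj (show (Fin.snoc x (ξ j x) : Fin (n + 1) → ℝ) ∈ graphOver S (ξ j) by simp [hx])
        rw [hdom] at this
        simp only [mem_setOf_eq, Fin.init_snoc, Fin.snoc_last] at this
        exact ⟨this.2.1, this.2.2⟩
      · have := hBs j hj (show (Fin.snoc x t : Fin (n + 1) → ℝ) ∈ bandOver S ξ j by simp [hx, hlo, hup])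
        rw [hdom] at this
        simp only [mem_setOf_eq, Fin.init_snoc, Fin.snoc_last] at this
        exact ⟨this.2.1, this.2.2⟩
  obtain ⟨j₀, j₁, hj01, hja, hjb, hBs'⟩ := exists_band_indices hmono hab hSne hfib
  -- 1. boundary functions and the good sub-base
  let G : Fin l → (Fin n → ℝ) → ℝ := fun i x => F (Fin.snoc x (ξ i x))
  have hGmem : ∀ i, j₀ ≤ i → i ≤ j₁ → ∀ x ∈ S, (Fin.snoc x (ξ i x) : Fin (n + 1) → ℝ) ∈ R.domain := by
    intro i h1 h2 x hx
    rw [hdom]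
    simp only [mem_setOf_eq, Fin.init_snoc, Fin.snoc_last]
    refine ⟨hSτ hx, ?_, ?_⟩
    · rw [← hja x hx]; exact (hmono x hx).monotone h1
    · rw [← hjb x hx]; exact (hmono x hx).monotone h2
  have hGsa : ∀ i, j₀ ≤ i ∧ i ≤ j₁ → IsSemialgebraicFunOn ℚ S (G i) := fun i hi =>
    IsSemialgebraicFunOn.comp_isSemialgebraicMapOn_holds hF (isSemialgebraicMapOn_snoc hS (hξs i))
      fun x hx => hGmem i hi.1 hi.2 x hx
  obtain ⟨S', hS'S, hS'o, hS'sa, hS'null, hS'd⟩ := exists_goodBase hSo hS G (fun i => j₀ ≤ i ∧ i ≤ j₁) hGsa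
  have hS'τ : S' ⊆ B.domain := hS'S.trans hSτ
  -- 2. per-band data
  have h0 : ∀ jj : Bs, (jj : Fin (l + 1)) ≠ 0 := fun jj h => by
    have := ((hBs' jj).mp jj.2).1; rw [h] at this; exact Nat.not_lt_zero _ this
  have hl : ∀ jj : Bs, (jj : Fin (l + 1)) ≠ Fin.last l := fun jj h => by
    have := ((hBs' jj).mp jj.2).2; rw [h, Fin.val_last] at this; exact absurd j₁.2 (not_lt.mpr this)
  let jp : Bs → Fin l := fun jj => (jj : Fin (l + 1)).pred (h0 jj)
  let jc : Bs → Fin l := fun jj => (jj : Fin (l + 1)).castPred (hl jj)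
  have hjp : ∀ jj, j₀ ≤ jp jj ∧ jp jj ≤ j₁ := fun jj => by
    have := (hBs' jj).mp jj.2
    simp only [jp, Fin.le_def, Fin.val_pred]; omega
  have hjc : ∀ jj, j₀ ≤ jc jj ∧ jc jj ≤ j₁ := fun jj => by
    have := (hBs' jj).mp jj.2
    simp only [jc, Fin.le_def, Fin.coe_castPred]; omega
  have hpc : ∀ jj, jp jj < jc jj := fun jj => by
    have := (hBs' jj).mp jj.2
    simp only [jp, jc, Fin.lt_def, Fin.val_pred, Fin.coe_castPred]; omega
  let cell : Bs → Set (Fin (n + 1) → ℝ) := fun jj => {z | (Fin.init z : Fin n → ℝ) ∈ S' ∧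
    ξ (jp jj) (Fin.init z) < z (Fin.last n) ∧ z (Fin.last n) < ξ (jc jj) (Fin.init z)}
  have hband : ∀ jj : Bs, bandOver S ξ jj = {z | (Fin.init z : Fin n → ℝ) ∈ S ∧
      ξ (jp jj) (Fin.init z) < z (Fin.last n) ∧ z (Fin.last n) < ξ (jc jj) (Fin.init z)} := fun jj => by
    ext z
    rw [mem_bandOver_iff, bandLower_of_ne_zero ξ _ (h0 jj), bandUpper_of_ne_last ξ _ (hl jj), EReal.coe_lt_coe_iff,
      EReal.coe_lt_coe_iff]
    rfl
  have hcell_sub : ∀ jj, cell jj ⊆ bandOver S ξ jj := fun jj z hz => by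
    rw [hband]; exact ⟨hS'S hz.1, hz.2.1, hz.2.2⟩
  have hcell_sa : ∀ jj, IsSemialgebraic ℚ (cell jj) := fun jj =>
    isSemialgebraic_cell hS'sa ((hξs _).mono hS'S hS'sa) ((hξs _).mono hS'S hS'sa)
  have hband_sa : ∀ jj : Bs, IsSemialgebraic ℚ (bandOver S ξ jj) := fun jj => isSemialgebraic_bandOver' hS hξs _
  let Rj : Bs → IntegralRep (n + 1) := fun jj => R.restrict _ (hband_sa jj) (hBs _ jj.2)
  let Rj' : Bs → IntegralRep (n + 1) := fun jj => R.restrict _ (hcell_sa jj) ((hcell_sub jj).trans (hBs _ jj.2))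
  -- 2a. shrinking the base is conull
  have hshrink : ∀ jj, Nonempty (Shadow (of (Rj jj) - of (Rj' jj))) := fun jj => by
    have := Shadow.of_restrict_conull (Rj jj) (hcell_sa jj) (hcell_sub jj) (by
      refine measure_mono_null (fun z hz => ?_) (volume_setOf_init_mem_eq_zero hS'null)
      simp only [Rj, IntegralRep.domain_restrict, Set.mem_sdiff, hband, mem_setOf_eq, cell, not_and] at hz ⊢
      exact ⟨hz.1.1, fun h => hz.2 h hz.1.2.1 hz.1.2.2⟩)
    exact this
  -- 2b. straightening each band
  have hQ : ∀ jj : Bs, ∃ Q : IntegralRep (n + 1), Q.domain = {z : Fin (n + 1) → ℝ | (Fin.init z : Fin n → ℝ) ∈ S' ∧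
        z (Fin.last n) ∈ Ioo (0 : ℝ) 1} ∧
      (Q.integrand = fun z => G (jc jj) (Fin.init z) - G (jp jj) (Fin.init z)) ∧
      Nonempty (Shadow (of (Rj' jj) - of Q)) := by
    intro jj
    have hx_ab : ∀ x ∈ S, a x ≤ ξ (jp jj) x ∧ ξ (jc jj) x ≤ b x := fun x hx =>
      ⟨by rw [← hja x hx]; exact (hmono x hx).monotone (hjp jj).1, by rw [← hjb x hx]; exact (hmono x hx).monotone (hjc jj).2⟩
    refine exists_bandShadow hS'o hS'sa ((hξs _).mono hS'S hS'sa) ((hξs _).mono hS'S hS'sa)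
      ((hξc _).mono hS'S) ((hξc _).mono hS'S) (fun x hx => hmono x (hS'S hx) (hpc jj)) (Rj' jj) rfl
      (hF.mono ((hcell_sub jj).trans (hBs _ jj.2)) (hcell_sa jj))
      (fun z hz => hsmooth _ jj.2 z (hcell_sub jj hz))
      (fun x hx => (hcont x (hS'τ hx)).mono (Icc_subset_Icc (hx_ab x (hS'S hx)).1 (hx_ab x (hS'S hx)).2))
      (fun x hx t ht => hderiv x (hS'τ hx) t ⟨(hx_ab x (hS'S hx)).1.trans_lt ht.1, ht.2.trans_le (hx_ab x (hS'S hx)).2⟩)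
      ?_ ((hGsa _ (hjp jj)).mono hS'S hS'sa) ((hGsa _ (hjc jj)).mono hS'S hS'sa) (hS'd _ (hjp jj)) (hS'd _ (hjc jj))
    rcases hsign _ jj.2 with h | h | h
    · exact Or.inl fun z hz => h z (hcell_sub jj hz)
    · exact Or.inr (Or.inl fun z hz => h z (hcell_sub jj hz))
    · exact Or.inr (Or.inr fun z hz => h z (hcell_sub jj hz))
  choose Q hQd hQi hQsh using hQ
  -- 3. partition of `RS` into the bands (the graphs are null)
  have hgraph_null : volume (⋃ i ∈ Gs, graphOver S (ξ i)) = 0 :=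
    (measure_biUnion_null_iff Gs.countable_toSet).mpr fun i _ =>
      volume_eq_zero_of_interior_eq_empty
        (Literature.ModelTheory.ExponentialFields.isSemialgebraicFunOn_iff_isSemialgebraic_graphOver.mp (hξs i))
        (interior_graphOver_eq_empty S (ξ i))
  obtain ⟨SP⟩ := Shadow.of_partition' RS Rj (fun jj z hz => by
      rw [hRS]; exact ⟨hBs _ jj.2 hz, (mem_bandOver_iff.mp hz).1⟩)
    (fun jj z _ => by simp [Rj, hRSi])
    (fun jj jj' hne => by
      refine measure_mono_null (fun z hz => ?_) measure_empty
      simp only [Rj, IntegralRep.domain_restrict, mem_inter_iff, mem_bandOver_iff] at hz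
      exact hne (Subtype.ext (band_eq_band ξ _ (hmono _ hz.1.1) ⟨hz.1.2.1, hz.1.2.2⟩ ⟨hz.2.2.1, hz.2.2.2⟩)))
    (by
      refine measure_mono_null (fun z hz => ?_) hgraph_null
      obtain ⟨hz1, hz2⟩ := hz
      rw [hRS] at hz1
      rcases hcov z hz1.1 hz1.2 with ⟨j, hj, hzj⟩ | ⟨j, hj, hzj⟩
      · exact mem_iUnion₂.mpr ⟨j, hj, hzj⟩
      · exact (hz2 (mem_iUnion.mpr ⟨⟨j, hj⟩, by simpa [Rj] using hzj⟩)).elim)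
  -- 4. the base: shrink, stabilise
  let BS' : IntegralRep n := B.restrict S' hS'sa hS'τ
  obtain ⟨SB⟩ := Shadow.of_partition BS (K := 1) (fun _ => BS') (fun _ => by rw [hBSd]; exact hS'S)
    (fun _ z _ => by simp [BS', hBSi]) (fun k k' h => (h (Subsingleton.elim k k')).elim)
    (by simpa [iUnion_const, hBSd, BS'] using hS'null)
  obtain ⟨Bst, hBstd, hBsti, -⟩ := exists_stabRep BS' n.le_succ
  obtain ⟨SBst⟩ := Shadow.of_stabPair BS' Bst n.le_succ hBstd hBsti
  have hBstd' : Bst.domain = {z : Fin (n + 1) → ℝ | (Fin.init z : Fin n → ℝ) ∈ S' ∧ z (Fin.last n) ∈ Ioo (0 : ℝ) 1} := by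
    rw [hBstd]; ext z; rw [mem_stabSet_succ]; rfl
  -- 5. telescoping by iterated rule (1b)
  obtain ⟨ST⟩ := Shadow.of_integrandSum Bst Q (fun jj => by rw [hQd, hBstd']) (fun z hz => by
    rw [hBstd'] at hz
    have hx : (Fin.init z : Fin n → ℝ) ∈ S := hS'S hz.1
    rw [hBsti, stabFun_succ_apply]
    simp only [BS', IntegralRep.integrand_restrict, hval _ (hSτ hx), hQi]
    have key := sum_bands_telescope hj01 hBs' (fun i => G i (Fin.init z))
    rw [← hja _ hx, ← hjb _ hx]
    change G j₁ (Fin.init z) - G j₀ (Fin.init z) = _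
    rw [← key, ← Finset.sum_coe_sort]
    refine Finset.sum_congr rfl fun jj _ => ?_
    rw [dif_pos ⟨h0 jj, hl jj⟩])
  -- 6. sum of the band shadows
  obtain ⟨SBands⟩ := Shadow.sum Finset.univ (fun jj : Bs => of (Rj jj) - of (Q jj)) fun jj _ => by
    obtain ⟨S1⟩ := hshrink jj
    obtain ⟨S2⟩ := hQsh jj
    exact S1.add S2 |>.map fun S3 => Classical.choice (S3.congr (by abel))
  -- 7. combine
  obtain ⟨S5⟩ := SP.add SBands
  obtain ⟨S6⟩ := S5.sub ST
  obtain ⟨S7⟩ := S6.sub SBst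
  obtain ⟨S8⟩ := S7.sub SB
  refine S8.congr ?_
  simp only [Finset.sum_sub_distrib, Fin.sum_univ_one]
  abel

/-! ### Headline -/

/-- Registered helper goal of the stub `stub_tameForm`: the open cell between two semialgebraic
functions over a semialgebraic base is semialgebraic (used for every band of file 26).
[cite: BCR1998, §2.2] -/
theorem tameForm_aux_cellSemialgebraic : ∀ {n : ℕ} {S : Set (Fin n → ℝ)}, IsSemialgebraic ℚ S → ∀ {lo hi : (Fin n → ℝ) → ℝ}, IsSemialgebraicFunOn ℚ S lo → IsSemialgebraicFunOn ℚ S hi → IsSemialgebraic ℚ {z : Fin (n + 1) → ℝ | (Fin.init z : Fin n → ℝ) ∈ S ∧ lo (Fin.init z) < z (Fin.last n) ∧ z (Fin.last n) < hi (Fin.init z)} :=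
  fun hS _ _ hlo hhi => isSemialgebraic_cell hS hlo hhi

end Summit.KontsevichZagierPeriods.KontsevichZagierPeriods.BetaCancellationDivisorSlicing

end
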